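import Literature.MathematicalPhysics.QuantumManyBody.GroundState
import Literature.MathematicalPhysics.QuantumManyBody.BoseGasThermodynamicLimitProofs
import Summits.AtomisticToContinuum.BoseEinsteinCondensation.Theorems.BECConjugateDominationHardCoreExtensionKineticTightness
import Mathlib.MeasureTheory.Function.LpSpace.Complete
import HarnessLib

/-!
# BECHardSphereReduction / HardCoreDominates — Rellich compactness for Dirichlet trial states
# (stub `stub_dirichletRellich`, 2b-R, of line `birth`)

Crux `HardCoreDominates` (stmt-AtomisticToContinuum-11884) of route `BECHardSphereReduction`, line
`birth`: near-minimisers of `v_t = v + t·1_{Iic R}` along `t → ∞` have bounded kinetic energy, and the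
analytic core of the cut to the hard core is a compactness statement in the tree's sequential
vocabulary. This file proves the registered stub `stub_dirichletRellich`:

  for `Ψ : ℕ → TrialState N L` with `energy 0 (Ψ k) ≤ B < ⊤` (bounded kinetic energy, Dirichlet
  trial states of the box `Λ_L = (0,L)³`), some subsequence converges in `L²((ℝ³)^N)` (`TendstoL2`
  of `GroundState.lean`) to a Borel measurable function `Ψ' : (ℝ³)^N → ℂ`

— Rellich–Kondrachov for `H¹₀(Λ_L^N)`. Proof (no physics, no case split on `N` or on the sign of
`L`): embed the Dirichlet states into the torus of side `L' = max L 1 > 0` by periodisation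
(`TrialState.toPeriodic` of `BoseGasThermodynamicLimitProofs.lean`; for the ZERO potential no
padding is needed, `TrialState.periodicEnergy_toPeriodic_le` with range `0`), so the periodic
energies are `≤ B`; the LANDED torus compactness
`KineticTightness.exists_subseq_sq_cauchy` (sibling crux `HardCoreExtension`, file
`Theorems/BECConjugateDominationHardCoreExtensionKineticTightness.lean`, Rellich through the free
form domain) yields an `L²(cell)`-Cauchy subsequence; on the cell the periodisation IS the
Dirichlet state and both vanish off `Λ_L^N ⊆ [0,L')^{3N}`, so the original subsequence is Cauchy in
`L²((ℝ³)^N)` (`lintegral_sub_sq_eq_setLIntegral_toPeriodic`); completeness of Mathlib's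
`Lp ℂ 2 volume` gives the limit class, whose canonical (strongly measurable) representative is `Ψ'`.
-/

noncomputable section

namespace Summit.AtomisticToContinuum.BoseEinsteinCondensation.Cruxes.HardCoreDominates.Birth

open MeasureTheory Filter
open scoped ENNReal NNReal Topology
open Literature.MathematicalPhysics.QuantumManyBody.BoseGas
open Summit.AtomisticToContinuum.BoseEinsteinCondensation.Cruxes.HardCoreExtension.ThirdLawCurrentFloor.KineticTightness
  (exists_subseq_sq_cauchy)

variable {N : ℕ} {L : ℝ}

/-- The `L²((ℝ³)^N)`-distance of two Dirichlet trial states of `Λ_L` is the `L²(cell)`-distance of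
their periodisations on any torus of side `L' ≥ L`, `L' > 0`: on the cell the periodisation is the
state itself, and both states vanish off `Λ_L^N ⊆ [0,L')^{3N}`. [folklore] -/
theorem lintegral_sub_sq_eq_setLIntegral_toPeriodic {L' : ℝ} (hL' : 0 < L') (hLL' : L ≤ L')
    (Ψ₁ Ψ₂ : TrialState N L) :
    ∫⁻ X, (‖Ψ₁.ψ X - Ψ₂.ψ X‖₊ : ℝ≥0∞) ^ 2 =
      ∫⁻ X in cellN N L',
        (‖(Ψ₁.toPeriodic hL' hLL').ψ X - (Ψ₂.toPeriodic hL' hLL').ψ X‖₊ : ℝ≥0∞) ^ 2 := by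
  have h1 : ∫⁻ X in cellN N L',
        (‖(Ψ₁.toPeriodic hL' hLL').ψ X - (Ψ₂.toPeriodic hL' hLL').ψ X‖₊ : ℝ≥0∞) ^ 2 =
      ∫⁻ X in cellN N L', (‖Ψ₁.ψ X - Ψ₂.ψ X‖₊ : ℝ≥0∞) ^ 2 := by
    refine setLIntegral_congr_fun (measurableSet_cellN N L') fun X hX => ?_
    change (‖periodize L' Ψ₁.ψ X - periodize L' Ψ₂.ψ X‖₊ : ℝ≥0∞) ^ 2 = _
    rw [periodize_of_mem_cellN hL' Ψ₁.ψ hX, periodize_of_mem_cellN hL' Ψ₂.ψ hX]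
  rw [h1, setLIntegral_eq_of_support_subset]
  intro X hX
  by_contra h
  have hb : X ∉ boxN N L := fun hb => h (boxN_subset_cellN hLL' hb)
  exact hX (by simp [Ψ₁.eq_zero X hb, Ψ₂.eq_zero X hb])

/-- A Dirichlet trial state is square integrable: `Ψ ∈ L²((ℝ³)^N)` with `‖Ψ‖₂ = 1`. [folklore] -/
theorem memLp_two_trialState (Ψ : TrialState N L) : MemLp Ψ.ψ 2 volume :=
  ⟨Ψ.contDiff.continuous.aestronglyMeasurable, by
    rw [eLpNorm_two_eq_rpow, Ψ.norm_eq, ENNReal.one_rpow]; exact ENNReal.one_lt_top⟩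

/-- **`stub_dirichletRellich`** (Rellich–Kondrachov for `H¹₀(Λ_L^N)`, sequential form). A sequence of
Dirichlet trial states `Ψ k` of the box `Λ_L` with bounded kinetic energy `∫ |∇Ψ k|² ≤ B < ⊤` has a
subsequence converging in `L²((ℝ³)^N)` to a Borel measurable function. (Periodise into the torus of
side `max L 1`, apply the torus compactness `exists_subseq_sq_cauchy` for the zero potential, pull the
`L²(cell)`-Cauchy property back to `(ℝ³)^N`, and take the limit in the complete space `Lp ℂ 2`.)
[folklore] -/
theorem stub_dirichletRellich :
    ∀ (N : ℕ) (L : ℝ) (B : ENNReal), B ≠ ⊤ →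
      ∀ Ψ : ℕ → Literature.MathematicalPhysics.QuantumManyBody.BoseGas.TrialState N L,
        (∀ k : ℕ, Literature.MathematicalPhysics.QuantumManyBody.BoseGas.energy 0 (Ψ k) ≤ B) →
          ∃ (Ψ' : Literature.MathematicalPhysics.QuantumManyBody.BoseGas.Config N → ℂ) (φ : ℕ → ℕ),
            StrictMono φ ∧ Measurable Ψ' ∧
              Literature.MathematicalPhysics.QuantumManyBody.BoseGas.TendstoL2 (fun i => Ψ (φ i)) Ψ' := by
  intro N L B hB Ψ hΨB
  -- a torus `[0, L')^{3N}`, `L' = max L 1 > 0`, containing the box `Λ_L^N`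
  set L' : ℝ := max L 1
  have hL' : 0 < L' := lt_max_of_lt_right one_pos
  have hLL' : L ≤ L' := le_max_left L 1
  -- the periodised states have periodic energy `≤ B` for the zero potential (and its truncations)
  set Φ : ℕ → PeriodicTrialState N L' := fun k => (Ψ k).toPeriodic hL' hLL'
  have hΦB : ∀ n : ℕ, periodicEnergy (fun r => min ((0 : ℝ → ℝ≥0∞) r) (n : ℝ≥0∞)) (Φ n) ≤ B := by
    intro n
    have h0 : (fun r => min ((0 : ℝ → ℝ≥0∞) r) (n : ℝ≥0∞)) = 0 := funext fun r => by simp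
    rw [h0]
    exact ((Ψ n).periodicEnergy_toPeriodic_le (v := 0) (R₀ := 0) (fun _ _ => rfl) hL' hLL'
      (by rw [add_zero]; exact hLL')).trans (hΨB n)
  -- Rellich on the torus: an `L²(cell)`-Cauchy subsequence
  obtain ⟨φ, hφ, hC⟩ := exists_subseq_sq_cauchy (N := N) (v := 0) measurable_const hL' hB Φ hΦB
  -- which is `L²((ℝ³)^N)`-Cauchy for the original states
  have hC' : ∀ ε : ℝ≥0∞, 0 < ε → ∃ I : ℕ, ∀ i j : ℕ, I ≤ i → I ≤ j →
      ∫⁻ X, (‖(Ψ (φ i)).ψ X - (Ψ (φ j)).ψ X‖₊ : ℝ≥0∞) ^ 2 ≤ ε := by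
    intro ε hε
    rcases eq_or_ne ε ⊤ with rfl | hεtop
    · exact ⟨0, fun i j _ _ => le_top⟩
    obtain ⟨I, hI⟩ := hC ε.toReal (ENNReal.toReal_pos hε.ne' hεtop)
    refine ⟨I, fun i j hi hj => ?_⟩
    rw [lintegral_sub_sq_eq_setLIntegral_toPeriodic hL' hLL', ← ENNReal.ofReal_toReal hεtop]
    exact hI i j hi hj
  -- the classes in `L²((ℝ³)^N)` form a Cauchy sequence
  have hmem : ∀ k, MemLp (Ψ k).ψ 2 volume := fun k => memLp_two_trialState (Ψ k)
  set g : ℕ → Lp ℂ 2 (volume : Measure (Config N)) := fun i => (hmem (φ i)).toLp _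
  have hg_sub : ∀ i j, eLpNorm (⇑(g i) - ⇑(g j)) 2 volume =
      (∫⁻ X, (‖(Ψ (φ i)).ψ X - (Ψ (φ j)).ψ X‖₊ : ℝ≥0∞) ^ 2) ^ (1 / 2 : ℝ) := by
    intro i j
    rw [eLpNorm_congr_ae ((hmem (φ i)).coeFn_toLp.sub (hmem (φ j)).coeFn_toLp),
      eLpNorm_two_eq_rpow]
    rfl
  have hCauchy : CauchySeq g := by
    rw [Lp.cauchySeq_Lp_iff_cauchySeq_eLpNorm]
    have h0 : Tendsto (fun n : ℕ × ℕ =>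
        ∫⁻ X, (‖(Ψ (φ n.1)).ψ X - (Ψ (φ n.2)).ψ X‖₊ : ℝ≥0∞) ^ 2) atTop (𝓝 0) := by
      rw [ENNReal.tendsto_atTop_zero]
      intro ε hε
      obtain ⟨I, hI⟩ := hC' ε hε
      exact ⟨(I, I), fun n hn => hI n.1 n.2 hn.1 hn.2⟩
    have h1 := ((ENNReal.continuous_rpow_const (y := (1 / 2 : ℝ))).tendsto 0).comp h0
    rw [ENNReal.zero_rpow_of_pos (by norm_num)] at h1
    refine h1.congr fun n => ?_
    rw [Function.comp_apply, hg_sub n.1 n.2]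
  -- completeness of `L²`: the limit class and its canonical measurable representative
  obtain ⟨F, hF⟩ := cauchySeq_tendsto_of_complete hCauchy
  refine ⟨(F : Config N → ℂ), φ, hφ, (Lp.stronglyMeasurable F).measurable, ?_⟩
  have h2 : Tendsto (fun i => eLpNorm (⇑(g i) - ⇑F) 2 volume) atTop (𝓝 0) :=
    (Lp.tendsto_Lp_iff_tendsto_eLpNorm' g F).1 hF
  have h3 : ∀ i, eLpNorm (⇑(g i) - ⇑F) 2 volume =
      (∫⁻ X, (‖(Ψ (φ i)).ψ X - F X‖₊ : ℝ≥0∞) ^ 2) ^ (1 / 2 : ℝ) := by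
    intro i
    rw [eLpNorm_congr_ae
        ((hmem (φ i)).coeFn_toLp.sub (EventuallyEq.rfl (f := (F : Config N → ℂ)))),
      eLpNorm_two_eq_rpow]
    rfl
  have h4 := ((ENNReal.continuous_rpow_const (y := (2 : ℝ))).tendsto 0).comp h2
  rw [ENNReal.zero_rpow_of_pos (by norm_num)] at h4
  show Tendsto (fun n => ∫⁻ X, (‖(Ψ (φ n)).ψ X - F X‖₊ : ℝ≥0∞) ^ 2) atTop (𝓝 0)
  refine h4.congr fun i => ?_
  rw [Function.comp_apply, h3 i, ← ENNReal.rpow_mul, one_div, inv_mul_cancel₀ two_ne_zero,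
    ENNReal.rpow_one]

end Summit.AtomisticToContinuum.BoseEinsteinCondensation.Cruxes.HardCoreDominates.Birth

end
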